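import Literature.Computability.Cryptography.GuessedCoinCall
import Literature.Computability.Cryptography.SISOracleKernel
import Literature.Computability.Cryptography.SISFunctionSolver
import HarnessLib

/-!
# The `SIS′` oracle of a reduction as a probability kernel: a PPT solver called with a guessed coin count

Topic `Computability/Cryptography` (family `pqc`). Sequel of `GuessedCoinCall.lean` (calling a PPT
subroutine `B` with a guessed coin count: `callRun`, `callLaw`, `le_toReal_callLaw`) and
`SISOracleKernel.lean` (`SIS.successProb'` as the mass of the pairing `A ∼ U, z ∼ kernel(A)`). The analyses
of Micciancio–Regev's reductions in the tree (`Algebra/EuclideanLattices/MRGapCVPRunD.lean`, Thm. 5.23;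
`DualGridAttemptSuccess.lean`, Thm. 5.9) take the `SIS′` oracle as an ARBITRARY kernel
`O : ℤ_q^{n×m} → PMF ℤᵐ` and charge its success as `δ′ = Pr_{A ∼ U, z ∼ O(A)}[IsSolution' A β z]`. The kernel a
MACHINE realises from a PPT solver `B` (whose exact coin budget it cannot compute) is

  `guessKernel B W R m A = (callLaw B W R (encodeMatrix A)).map (decodeIntVec m)`,

and this file proves its success is at least `2^{−W}` times that of `B`:

* `guessKernel` (definition with body);
* `toReal_pairing_eq_tsum` — `Pr_{A ∼ U, z ∼ O(A)}[E] = ∑_A U(A) · O(A)(E_A)`;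
* **`le_toReal_pairing_guessKernel`** — if `B.coinLen |encodeMatrix A| ≤ R` and `< 2^W` for all
  `A ∈ ℤ_q^{n×m}`, then `2^{−W} · SIS.successProb' B n m q β ≤ Pr_{A ∼ U, z ∼ guessKernel(A)}[IsSolution' A β z]`;
* `coinLen_encodeMatrix_le_supBudget` — with a bound `cb` of the coin budget, `R = supBudget cb n m q =
  max_{ℓ ≤ matBound n m q} cb ℓ` qualifies (`SIS.length_encodeMatrix_le`).

All proved; no named fact.

## References

* D. Micciancio, O. Regev, *Worst-case to average-case reductions based on Gaussian measures*, SIAM J. Comput.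
  37 (2007) 267–302, Def. 5.4 and the proofs of Thm. 5.9 / Thm. 5.23 ("using the oracle", pp. 22, 29).
* O. Goldreich, *Foundations of Cryptography I*, CUP 2001, §1.3.2 (invoking a PPT subroutine) [Goldreich2001].
-/

noncomputable section

namespace Literature.Computability.Cryptography

namespace GuessedCoinCall

open Literature.Computability.Complexity Literature.Algebra.EuclideanLattices PMF MeasureTheory Finset SIS
open scoped ENNReal

variable {n m q : ℕ} [NeZero q]

/-- **The `SIS′` oracle kernel realised by a machine**: query the code of `A`, call `B` with a guessed coin
count, read the answer as an integer vector of dimension `m`. [cite: MicciancioRegev2007, Thm. 5.23 (proof, p. 29: "using the oracle")] -/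
def guessKernel (B : RandAlg (List Bool) (List Bool)) (W R m : ℕ) (A : Matrix (Fin n) (Fin m) (ZMod q)) :
    PMF (Fin m → ℤ) :=
  (callLaw B W R (encodeMatrix A)).map (decodeIntVec m)

/-- **The mass of the pairing is the uniform average of the kernel's masses.** [folklore] -/
theorem toReal_pairing_eq_tsum (O : Matrix (Fin n) (Fin m) (ZMod q) → PMF (Fin m → ℤ))
    (E : Set (Matrix (Fin n) (Fin m) (ZMod q) × (Fin m → ℤ))) :
    ((((uniformOfFintype (Matrix (Fin n) (Fin m) (ZMod q))).bind fun A => (O A).map (Prod.mk A)).toOuterMeasure E).toReal =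
      ∑' A, (uniformOfFintype (Matrix (Fin n) (Fin m) (ZMod q)) A).toReal * ((O A).toOuterMeasure (Prod.mk A ⁻¹' E)).toReal) := by
  rw [toReal_toOuterMeasure_bind_apply]
  refine tsum_congr fun A => ?_
  rw [PMF.toOuterMeasure_map_apply]

/-- **The guessed kernel succeeds at least `2^{−W}` times as often as `B`.**
[cite: MicciancioRegev2007, Def. 5.4; Goldreich2001, §1.3.2] -/
theorem le_toReal_pairing_guessKernel (B : RandAlg (List Bool) (List Bool)) {W R : ℕ}
    (hR : ∀ A : Matrix (Fin n) (Fin m) (ZMod q), B.coinLen (encodeMatrix A).length ≤ R)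
    (hW : ∀ A : Matrix (Fin n) (Fin m) (ZMod q), B.coinLen (encodeMatrix A).length < 2 ^ W) (β : ℝ) :
    (2⁻¹ : ℝ) ^ W * successProb' B n m q β ≤
      ((((uniformOfFintype (Matrix (Fin n) (Fin m) (ZMod q))).bind fun A =>
          (guessKernel B W R m A).map (Prod.mk A)).toOuterMeasure {az | IsSolution' az.1 β az.2}).toReal) := by
  rw [toReal_pairing_eq_tsum, successProb', matrixAvg_eq_tsum, ← tsum_mul_left, tsum_fintype, tsum_fintype]
  refine Finset.sum_le_sum fun A _ => ?_
  rw [mul_left_comm]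
  refine mul_le_mul_of_nonneg_left ?_ ENNReal.toReal_nonneg
  have h := le_toReal_callLaw (A := B) (W := W) (R := R) (hR A) (hW A) {w | IsSolution' A β (decodeIntVec m w)}
  refine h.trans (le_of_eq ?_)
  rw [guessKernel, PMF.toOuterMeasure_map_apply]
  rfl

/-- A common supply for all queries in `ℤ_q^{n×m}`: `supBudget cb n m q = max_{ℓ ≤ matBound n m q} cb ℓ`. [folklore] -/
def supBudget (cb : ℕ → ℕ) (n m q : ℕ) : ℕ := (Finset.range (matBound n m q + 1)).sup cb

/-- With `coinLen ≤ cb` pointwise, `coinLen |encodeMatrix A| ≤ supBudget cb n m q`. [folklore] -/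
theorem coinLen_encodeMatrix_le_supBudget (B : RandAlg (List Bool) (List Bool)) {cb : ℕ → ℕ}
    (hcb : ∀ ℓ, B.coinLen ℓ ≤ cb ℓ) (A : Matrix (Fin n) (Fin m) (ZMod q)) :
    B.coinLen (encodeMatrix A).length ≤ supBudget cb n m q :=
  (hcb _).trans (Finset.le_sup (f := cb) (Finset.mem_range.2 (Nat.lt_succ_of_le (length_encodeMatrix_le A))))

/-- With a MONOTONE bound (e.g. a polynomial over `ℕ`), `coinLen |encodeMatrix A| ≤ cb (matBound n m q)`. [folklore] -/
theorem coinLen_encodeMatrix_le_of_monotone (B : RandAlg (List Bool) (List Bool)) {cb : ℕ → ℕ}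
    (hcb : ∀ ℓ, B.coinLen ℓ ≤ cb ℓ) (hmono : Monotone cb) (A : Matrix (Fin n) (Fin m) (ZMod q)) :
    B.coinLen (encodeMatrix A).length ≤ cb (matBound n m q) :=
  (hcb _).trans (hmono (length_encodeMatrix_le A))

/-- Polynomials over `ℕ` evaluate monotonically. [folklore] -/
theorem natPoly_eval_monotone (p : Polynomial ℕ) : Monotone fun x => p.eval x := fun a b h => by
  show p.eval a ≤ p.eval b
  rw [Polynomial.eval_eq_sum_range, Polynomial.eval_eq_sum_range]
  exact Finset.sum_le_sum fun i _ => Nat.mul_le_mul_left _ (Nat.pow_le_pow_left h i)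

end GuessedCoinCall

end Literature.Computability.Cryptography

end
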